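import Literature.NumberTheory.EllipticCurves.CuspFormLFunction
import Literature.NumberTheory.EllipticCurves.GaloisAction
import HarnessLib
import HarnessLib.Audit.Tags

/-!
# Candidates E-es-40 / E-es-40₂ (es g12, MEMO-es §25.1): hNT(t) FOR CURVES —
# `NotTrivialEisensteinOfIrreducibleTwo` and `NotTrivialEisensteinOfIrreducibleAtTwo` — cell `bsd-f2-manin`
# (D-0131 (3) frontier: the Manin constant at additive primes). `@[conjecture]` leaf: NOTHING asserted, two
# definitions, no edges; companion of `RelativeIharaShiftVanishingParabolic.lean` (E-es-36o / E-es-36x).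

HONEST FRAMING. LENS = Euler systems / explicit reciprocity (planner `bsd-f2-manin-es` g12; HOME
`run/shared/lean/pub/bsd-f2-manin/MEMO-es.md` §25.1 «the hypothesis that survives `C₃`: hNT(t)»). Source of the two
Props: HOME/es/Sketch-es-g12.lean sha16 bafda0a73947a51a, declarations `EsG12.NotTrivialEisensteinOfIrreducibleTwo`
(E-es-40) and `EsG12.NotTrivialEisensteinOfIrreducibleAtTwo` (E-es-40₂, the `f`-free `t = 2` half added 04:36Z for
the line prover's `hvan8`, which carries no newform binder), copied VERBATIM (no helper to unfold). hNT(t) for a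
system `λ` off `S` means: for every `M` some prime `r ∉ S` with `r ≡ 1 (mod t^M)` has `λ r ≠ r + 1`; here
`λ r = a_r(W) mod 2 = W.LFunction r mod 2`, so for odd `r` the conclusion reads «`a_r(W)` is odd».

THE ROWS (HOME/CANDIDATES.md §E.2 l.297). **E-es-40**: `W/ℚ` elliptic with `W[2]` irreducible (mod-2 image `S₃`
or `C₃`), `f` its newform of level `N`, `t` prime with `t = 2` or `t² ∤ N` ⟹ for every finite `S` and every `M`
there is a prime `r ∉ S`, `r ≡ 1 (mod t^M)`, with `a_r(W) ≢ r + 1 (mod 2)`. **E-es-40₂**: the `t = 2` clause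
without the newform binder. WHY THE CELL WANTS THEM (MEMO-es §25.4; line prover p3,
`Summits/BirchSwinnertonDyer/BirchSwinnertonDyer/Theorems/ManinLocalTwoThreeGenerationTwoParabolicExact.lean`,
p605607, `multiShiftClassGenerationTwo_of_parabolicVanishing_exact (hvan8) (hvanq)`): they supply the hypothesis
hNT(2) (for `hvan8`, from E-es-40₂) and hNT(t), `t` odd with `t ∥ N` (for `hvanq`, from E-es-40 via the right
disjunct) under which the parabolic relative Ihara leaves E-es-36o(2,2,3) / E-es-36x(2,t,1) fire, discharging the
registered stub `stub_cThreeImageResidual` of the C2 line `kato_shift_two` (crux `ManinOddAtFour`,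
stmt-BirchSwinnertonDyer-22967; the 3 950 `C₃`-image optimal classes with `4 ∣ N`, for which «`λ̄` not
Eisenstein» is FALSE — `a_r ≡ χ(r) + rχ²(r)` over `𝔽₄` — while hNT(t) along `t`-POWER congruences holds).
STATUS CLAIMED BY es (§25.1; REF1 §R47 (7) concurs: «E-es-40's clause `t = 2 ∨ ¬ t² ∣ N` is EXACTLY right»):
THEOREM-candidate by Chebotarev's density theorem in `ℚ(W[2], ζ_{t^M})`: `a_r(W) ≡ tr ρ̄_{W,2}(Frob_r) (mod 2)` for
good `r`, and in `GL₂(𝔽₂) ≅ S₃` trace `1` ⟺ order `3`; image `S₃`: `ℚ(W[2]) ∩ ℚ(ζ_{t^∞})` lies in the quadratic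
resolvent, on which order-`3` elements act trivially, so (order `3`, `ζ ↦ ζ`) is a Galois element — every `t`;
image `C₃`: `ℚ(W[2])` cyclic cubic — `t = 2`: `ℚ(ζ_{2^∞})` has no cubic subfield; `t` odd with `t² ∤ N`: good or
multiplicative reduction at `t` ⟹ inertia at `t` acts on `W[2]` through a group of order `≤ 2` ⟹ `ℚ(W[2])`
unramified at `t` ⟹ not inside `ℚ(ζ_{t^∞})`. SCOPE CAVEAT (es §25.1, REF1 (7)): for `t` odd with `t² ∣ N` the
statement can FAIL (`C₃` image with `cond ℚ(W[2]) ∈ {t, 9}`) — excluded by the clause; no odd-`t` shift is taken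
at additive `t` by the consumer. The typer's own check (g9): the `r` is chosen by the statement (∃), so bad primes
and `r = 2` (possible only at `M = 0`) are avoided inside any proof; no vacuity at `M = 0` or `S = ∅`.

NOT IN PRINT as statements; theorem-level consequences of Chebotarev's density theorem (Neukirch, *Algebraic Number
Theory* VII (13.4); effective: Lagarias–Odlyzko 1977) and `tr ρ̄_{E,ℓ}(Frob_p) = a_p` (Darmon–Diamond–Taylor 1995
Prop. 2.11 (a), p. 57); Chebotarev for `ℚ(E[p], ζ_m)` is NOT in the tree (module docstring of
`Literature/NumberTheory/EllipticCurves/ModPReducibility.lean`), which is why the `p` odd analogue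
`not_isEisensteinEigensystem_of_hasIrreducibleModPGaloisRep` (p596515) is a named Literature fact and these two
`p = 2`, congruence-class-restricted statements are filed as obligations (REF1 §R47 typing note: «F-es-26′ + F-es-27
are the only FACT candidates» of the §25 package). A `_holds` proof from a future tree Chebotarev theorem is ~40 lines.

BC5 WITNESS: n/a directly (curve-side hypotheses, not laws about `c_E`); the consumer's census of record is
HOME/es/E19B-SHIFT2-levels-v1.tsv 055a83920c785e77 (196 levels `N = 4k ≤ 800`, Hecke-stable multi-shift
annihilator = realised diamond span at 196/196, nonEis 0/196), which includes the seven `C₃` levels 196, 324, 392,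
588, 648, 676, 784; ecdata galrep count of the `C₃`-image (`2Cn`) optimal classes with `4 ∣ N`: 3 950 (MEMO-es §22.8).
Cheapest falsifier (es §25.5, not run — theorem-candidate): a `C₃`-image curve with `a_r` even for all
`r ≡ 1 (mod 2^M)`, `r ≤ 10⁴`. Beyond-print rows: n/a.
REFUTER VERDICTS AT FILING (2026-08-28): REF1 §R47 (R-es-25): E-es-40 SURVIVES (theorem-candidate; clause exactly
right); E-es-40₂ (posted 04:36Z, after §R47) is E-es-40's `t = 2` clause with the idle newform binder dropped —
not separately audited; REF2 R-es-25 placement PENDING. A refuter-repaired text, if any, lands under a NEW name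
(suffix `R`) per the tree's append-only rule.
-/

noncomputable section

open scoped MatrixGroups ModularForm

open CongruenceSubgroup
  Literature.NumberTheory.EllipticCurves Literature.NumberTheory.EllipticCurves.ModularForms

namespace Summit.BirchSwinnertonDyer.Rank1Residual.ManinAdditive

/-- **Candidate E-es-40 `NotTrivialEisensteinOfIrreducibleTwo` (cell bsd-f2-manin, es g12; nothing asserted).**
For an elliptic curve `W/ℚ` with `W[2]` an irreducible Galois module (mod-2 image `S₃` or `C₃`), `f` the newform
of level `N` attached to `W`, and a prime `t` with `t = 2` or `t² ∤ N`: for every finite set `S` of naturals and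
every `M`, there is a prime `r ∉ S` with `r ≡ 1 (mod t^M)` and `a_r(W) ≢ r + 1 (mod 2)` (`a_r(W) = W.LFunction r`;
for odd `r`: `a_r(W)` odd), i.e. the system `r ↦ a_r(W) mod 2` satisfies hNT(t) off `S`. VERBATIM
HOME/es/Sketch-es-g12.lean bafda0a73947a51a `EsG12.NotTrivialEisensteinOfIrreducibleTwo`. Theorem-candidate by
Chebotarev's density theorem in `ℚ(W[2], ζ_{t^M})` (see the module docstring; the clause `t = 2 ∨ ¬ t² ∣ N` is
load-bearing in the `C₃` case). Not a printed statement; Chebotarev is not in the tree.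
[cite: DarmonDiamondTaylor1995, Prop. 2.11 (a) p. 57 (shape only: `tr ρ_{E,ℓ}(Frob_p) = a_p`; the congruence-class-restricted odd-trace statement is a Chebotarev consequence NOT in print as such — cell memo MEMO-es §25.1)] -/
@[conjecture]
def NotTrivialEisensteinOfIrreducibleTwo : Prop :=
  ∀ (W : WeierstrassCurve ℚ) [W.IsElliptic] {N : ℕ} [NeZero N] (f : CuspForm (Gamma0 N) 2),
    IsNewformOf W f → W.HasIrreducibleModPGaloisRep 2 →
    ∀ t : ℕ, t.Prime → (t = 2 ∨ ¬ t ^ 2 ∣ N) →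
    ∀ (S : Finset ℕ) (M : ℕ), ∃ r : ℕ, r.Prime ∧ r ∉ S ∧ r ≡ 1 [MOD t ^ M] ∧
      (((W.LFunction r : ℤ) : ZMod 2)) ≠ (r : ZMod 2) + 1

/-- **Candidate E-es-40₂ `NotTrivialEisensteinOfIrreducibleAtTwo` (cell bsd-f2-manin, es g12; nothing asserted).**
The `f`-free `t = 2` half of E-es-40 (matches the line prover's `hvan8`, which has no newform binder): for an
elliptic curve `W/ℚ` with `W[2]` irreducible, every finite `S` and every `M`, there is a prime `r ∉ S`,
`r ≡ 1 (mod 2^M)`, with `a_r(W) ≢ r + 1 (mod 2)` (for `M ≥ 1`: `a_r(W)` odd). VERBATIM HOME/es/Sketch-es-g12.lean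
bafda0a73947a51a `EsG12.NotTrivialEisensteinOfIrreducibleAtTwo`. Theorem-candidate by Chebotarev in
`ℚ(W[2], ζ_{2^M})` (no conductor clause needed: `ℚ(ζ_{2^∞})` has no cubic subfield; see the module docstring).
Not a printed statement; Chebotarev is not in the tree.
[cite: DarmonDiamondTaylor1995, Prop. 2.11 (a) p. 57 (shape only: `tr ρ_{E,ℓ}(Frob_p) = a_p`; the `2`-power-congruence-class odd-trace statement is a Chebotarev consequence NOT in print as such — cell memo MEMO-es §25.1)] -/
@[conjecture]
def NotTrivialEisensteinOfIrreducibleAtTwo : Prop :=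
  ∀ (W : WeierstrassCurve ℚ) [W.IsElliptic], W.HasIrreducibleModPGaloisRep 2 →
    ∀ (S : Finset ℕ) (M : ℕ), ∃ r : ℕ, r.Prime ∧ r ∉ S ∧ r ≡ 1 [MOD 2 ^ M] ∧
      (((W.LFunction r : ℤ) : ZMod 2)) ≠ (r : ZMod 2) + 1

end Summit.BirchSwinnertonDyer.Rank1Residual.ManinAdditive

end
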